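import Summits.HubbardSuperconductivity.HubbardSuperconductivity.Theorems.AnisotropyChordTransferFibre3FinX5Eval

/-!
# Route `AnisotropyChord` / H0 rotor rung: FIN per-`L` GM₃ (X5), `L = 33` — row-C cell facts (X5, point wedges), part `p46`

Kernel facts `xcCellAnyA0 33 (49/50) 100 la lb bn tb = true` (row C of cert cells 112, 113 of `L = 33` with `b = bn/100` and the `T⁺·D` brackets `tb` exported by the row-`N₁` facts `xn33_*`): the two Green point wedges `gWedgePt` are recomputed in the kernel, the profile / gradient tables are built from them by monotonicity (`…FinX5Eval`), and g5's row-C check is decided; assembled in `…FinX5GM3ThirtyThree`.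
Prover seat `hubbard-h0-rotor-p3` g8; helper for piece A = stmt-HubbardSuperconductivity-23918 of rung 19089 (`--supports`, helper class).
WHAT THIS IS NOT: nothing here proves superconductivity in the Hubbard model (rotor TARGET as worded stays FALSE, g15 verdict); kernel facts for the FIN certificate of ONE conditional reduction.  Tree imports only; zero data; standard axioms.
-/

set_option linter.dupNamespace false
set_option autoImplicit false

namespace Summit.HubbardSuperconductivity.HubbardSuperconductivity.Theorems.AnisotropyChord.Transfer.Fibre3

namespace FinXD

open FinXB FinCell Hole2

set_option maxHeartbeats 4000000 in
/-- row C of cell 112 of `L = 33` (`b = 87/100`). [folklore] -/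
theorem xc33_112 : xcCellAnyA0 33 (49/50 : ℚ) 100 760675414383578 779692299743168 87 ((2288334584344097 : ℤ), (2349184051426369 : ℤ)) = true := by decide +kernel

set_option maxHeartbeats 4000000 in
/-- row C of cell 113 of `L = 33` (`b = 88/100`). [folklore] -/
theorem xc33_113 : xcCellAnyA0 33 (49/50 : ℚ) 100 779692299743168 799184607236747 88 ((2345899751934420 : ℤ), (2408318673423420 : ℤ)) = true := by decide +kernel

end FinXD

end Summit.HubbardSuperconductivity.HubbardSuperconductivity.Theorems.AnisotropyChord.Transfer.Fibre3
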